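import Summits.Ventures.Crystal3D.Theorems.StickyWulffConstantCoaxialWallLawSeamSealedRow
import HarnessLib

/-!
# END-BALL RIGIDITY: a saturated (A)-end ball has a NON-close-packed contact shell; and `ThreePayer` from two automaton-free saturation-census facts
# (crux `CoaxialWallLaw`, stmt-Ventures-19481; line `WallLedgerF`, skeleton 'CoaxialWallLawCertificates', T5b input `ThreePayer` of '…SeamThreePayer')

HONEST FRAMING. Venture `Summits/Ventures/Crystal3D` (cell `crystal3d-full`); helper for the T5b input of record.  `ThreePayer` ('…SeamThreePayer': every (A)-end ball
`b ≠ z` within `1` of a payer `z` has pooled deficiency `≥ 3`) is REDUCED here to two census statements about `1`-separated unit-ball packings that do not mention the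
word automaton:
* **`SatCensus11`** — a ball with exactly eleven contacts has two distinct contact-neighbours with at most eleven contacts each;
* **`SatCensus12`** — a ball with twelve contacts whose contact shell is NOT arranged in the fcc or hcp kissing pattern has contact-neighbours of total deficiency `≥ 3`.
(Both hold with margin in every Barlow packing with vacancies: a neighbour of a vacancy has four unsaturated neighbours; saturated Barlow balls have arranged shells.
`KissingGap (5/2)` + `KissingClassification (5/2)` give `SatCensus12` with `2` in place of `3` — `two_unsaturated_of_not_closePacked`; the third unit is the open part.)
The bridge is **`not_arranged_of_isEndPairA`**: a twelve-fold (A)-END ball cannot have an arranged shell — three linearly independent exact slots of the class frame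
sit in its shell (the reader and two face mates: full / narrow / glide / cross readers alike), so an arranged shell is the class frame's full dozen or a twin dozen with
the reader on the own side ('…SlotDozens' single-dozen algebra, as in '…DozenStep'), and either makes the end ball MOVING — contradiction.  NO kissing facts needed.
* `fullShell_or_twinDozen_of_isArrangedIn` ('…DozenStep's dichotomy with the arrangement as hypothesis instead of saturation), `isMoving_of_arranged_face` (tail),
  **`not_arranged_of_isEndPairA`**, `two_unsaturated_of_isEndPairA_twelve` (under the kissing facts: a twelve-fold end ball has two unsaturated neighbours — the
  exported two-payer clause re-derived from `IsEndPairA`), `SatCensus11`, `SatCensus12`, **`threePayer_of_census : SatCensus11 → SatCensus12 → ThreePayer`**.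
WHAT THIS IS NOT: neither census fact is proved (the closing chain of lane F then reads `t5b_of_threePayer_of_sealedWin₃ stub_E1 (threePayer_of_census c11 c12) cert`);
F-C1 not moved.
-/

noncomputable section

namespace Summit.Ventures.Crystal3D.Theorems

namespace TailResidue

open Summit.Ventures.Crystal3D Finset
open Literature.Geometry.DiscreteGeometry (fccKissingPattern hcpKissingPattern IsArrangedIn)
open scoped InnerProductSpace

variable {X : Finset (EuclideanSpace ℝ (Fin 3))}

/-! ### The dichotomy of an ARRANGED dozen over three independent exact slots -/

/-- **Full shell or twin dozen, from an ARRANGED shell** ('…DozenStep' `fullShell_or_twinDozen_of_allButOne` with the arrangement as hypothesis): if the contact shell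
of `y` is arranged in the fcc or hcp kissing pattern and contains three linearly independent exact slots of the frame `A`, then either all twelve slots are occupied,
or for a unit menu normal `n` of `A` the nine own slots and the three mirror sites are occupied, the three far slots are empty, and `a, b, c` lie on the own side. -/
theorem fullShell_or_twinDozen_of_isArrangedIn {y : EuclideanSpace ℝ (Fin 3)}
    (harr : IsArrangedIn ((fun q => (2 : ℝ) • (q - y)) '' {q | q ∈ X ∧ dist y q = 1}) fccKissingPattern ∨
      IsArrangedIn ((fun q => (2 : ℝ) • (q - y)) '' {q | q ∈ X ∧ dist y q = 1}) hcpKissingPattern)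
    (A : EuclideanSpace ℝ (Fin 3) ≃ₗᵢ[ℝ] EuclideanSpace ℝ (Fin 3)) {a b c : EuclideanSpace ℝ (Fin 3)}
    (ha : a ∈ fccSlots) (hb : b ∈ fccSlots) (hc' : c ∈ fccSlots) (hind : LinearIndependent ℝ ![a, b, c])
    (haX : y + A a ∈ X) (hbX : y + A b ∈ X) (hcX : y + A c ∈ X) :
    (∀ w ∈ fccSlots, y + A w ∈ X) ∨
    ∃ n : EuclideanSpace ℝ (Fin 3), ‖n‖ = 1 ∧
      (∀ w ∈ fccSlots, ⟪A w, n⟫_ℝ = 0 ∨ ⟪A w, n⟫_ℝ = Real.sqrt (2 / 3) ∨ ⟪A w, n⟫_ℝ = -Real.sqrt (2 / 3)) ∧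
      (∀ w ∈ fccSlots, ⟪A w, n⟫_ℝ ≤ 0 → y + A w ∈ X) ∧
      (∀ w ∈ fccSlots, ⟪A w, n⟫_ℝ < 0 → y + (A w - (2 * ⟪A w, n⟫_ℝ) • n) ∈ X) ∧
      (∀ w ∈ fccSlots, 0 < ⟪A w, n⟫_ℝ → y + A w ∉ X) ∧
      ⟪A a, n⟫_ℝ ≤ 0 ∧ ⟪A b, n⟫_ℝ ≤ 0 ∧ ⟪A c, n⟫_ℝ ≤ 0 := by
  obtain ⟨P, B, hP, hocc, hall⟩ : ∃ (P : Finset (EuclideanSpace ℝ (Fin 3))) (B : EuclideanSpace ℝ (Fin 3) →ₗᵢ[ℝ] EuclideanSpace ℝ (Fin 3)),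
      (P = fccKissingPattern ∨ P = hcpKissingPattern) ∧ (∀ p ∈ P, y + B p ∈ X ∧ dist y (y + B p) = 1) ∧
      ∀ q ∈ X, dist y q = 1 → ∃ p ∈ P, q = y + B p := by
    rcases harr with h | h
    · obtain ⟨B, h1, h2⟩ := neighbours_eq_of_isArrangedIn h
      exact ⟨fccKissingPattern, B, Or.inl rfl, h1, h2⟩
    · obtain ⟨B, h1, h2⟩ := neighbours_eq_of_isArrangedIn h
      exact ⟨hcpKissingPattern, B, Or.inr rfl, h1, h2⟩
  have key : ∀ w ∈ fccSlots, y + A w ∈ X → A w ∈ B '' (↑P : Set (EuclideanSpace ℝ (Fin 3))) := by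
    intro w hw hwX
    have hd : dist y (y + A w) = 1 := by
      rw [dist_self_add_right, LinearIsometryEquiv.norm_map, norm_eq_one_of_mem_fccSlots hw]
    obtain ⟨p, hp, he⟩ := hall _ hwX hd
    exact ⟨p, Finset.mem_coe.2 hp, (add_left_cancel he).symm⟩
  have back : ∀ v ∈ B '' (↑P : Set (EuclideanSpace ℝ (Fin 3))), y + v ∈ X := by
    rintro v ⟨p, hp, rfl⟩; exact (hocc p (Finset.mem_coe.1 hp)).1
  have slotA : ∀ w ∈ fccSlots, A w ∈ A '' (↑fccSlots : Set (EuclideanSpace ℝ (Fin 3))) := fun w hw => ⟨w, Finset.mem_coe.2 hw, rfl⟩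
  have hind' : LinearIndependent ℝ ![A a, A b, A c] := linearIndependent_map_triple A hind
  rcases hP with rfl | rfl
  · left
    have hEq := fccDozen_eq_slots_of_three_independent A B (key a ha haX) (key b hb hbX) (key c hc' hcX) (slotA a ha) (slotA b hb) (slotA c hc') hind'
    intro w hw
    apply back
    rw [hEq]; exact slotA w hw
  · right
    obtain ⟨n, hn, hmenu, hD⟩ := hcpDozen_twin_of_three_independent A B (key a ha haX) (key b hb hbX) (key c hc' hcX) (slotA a ha) (slotA b hb) (slotA c hc') hind'
    refine ⟨n, hn, hmenu, ?_, ?_, ?_, (slot_mem_twinDozen_iff A hn hmenu hD ha).1 (key a ha haX), (slot_mem_twinDozen_iff A hn hmenu hD hb).1 (key b hb hbX),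
      (slot_mem_twinDozen_iff A hn hmenu hD hc').1 (key c hc' hcX)⟩
    · intro w hw hle
      apply back; rw [hD]; exact Or.inl ⟨w, ⟨hw, hle⟩, rfl⟩
    · intro w hw hlt
      apply back; rw [hD]; exact Or.inr ⟨w, ⟨hw, hlt⟩, rfl⟩
    · intro w hw hpos hwX
      have := (slot_mem_twinDozen_iff A hn hmenu hD hw).1 (key w hw hwX)
      linarith

/-! ### The tail: an arranged shell over «reader + two face mates» makes the ball moving -/

/-- Three slots of the shape `c₁ − a, c₂ − a, −a` (a face `{a, c₁, c₂}` seen from its vertex `a`) are linearly independent. -/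
theorem linearIndependent_face_from_vertex {a c₁ c₂ : EuclideanSpace ℝ (Fin 3)} (ha : a ∈ fccSlots) (hc₁ : c₁ ∈ fccSlots) (hc₂ : c₂ ∈ fccSlots)
    (h1 : ⟪a, c₁⟫_ℝ = 1 / 2) (h2 : ⟪a, c₂⟫_ℝ = 1 / 2) (h12 : ⟪c₁, c₂⟫_ℝ = 1 / 2) : LinearIndependent ℝ ![c₁ - a, c₂ - a, -a] := by
  have hna : ‖-a‖ = 1 := by rw [norm_neg, norm_eq_one_of_mem_fccSlots ha]
  have hn1 : ‖-c₁‖ = 1 := by rw [norm_neg, norm_eq_one_of_mem_fccSlots hc₁]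
  have hn2 : ‖-c₂‖ = 1 := by rw [norm_neg, norm_eq_one_of_mem_fccSlots hc₂]
  have i1 : ⟪-c₁, -a⟫_ℝ = 1 / 2 := by rw [inner_neg_neg, real_inner_comm, h1]
  have i2 : ⟪-c₁, -c₂⟫_ℝ = 1 / 2 := by rw [inner_neg_neg, h12]
  have i3 : ⟪-a, -c₂⟫_ℝ = 1 / 2 := by rw [inner_neg_neg, h2]
  have h := linearIndependent_sub_sub_self hn1 hna hn2 i1 i2 i3
  have e : (![-a - -c₁, -a - -c₂, -a] : Fin 3 → EuclideanSpace ℝ (Fin 3)) = ![c₁ - a, c₂ - a, -a] := by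
    simp only [neg_sub_neg]
  rw [e] at h
  exact h

/-- **Tail lemma.** If the shell of `b` is arranged and contains, in the frame `A`, the ball `b + A(−a)` (the reader) and the two face mates `b + A(c₁ − a)`, `b + A(c₂ − a)`
of a slot face `{a, c₁, c₂}`, then `b` is MOVING in the class `(A, A a)` (full shell, or twin dozen with the reader on the own side ⇒ cross or glide). -/
theorem isMoving_of_arranged_face {v : WordVersion} (A : EuclideanSpace ℝ (Fin 3) ≃ₗᵢ[ℝ] EuclideanSpace ℝ (Fin 3)) {b a c₁ c₂ : EuclideanSpace ℝ (Fin 3)}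
    (ha : a ∈ fccSlots) (hc₁ : c₁ ∈ fccSlots) (hc₂ : c₂ ∈ fccSlots) (h1 : ⟪a, c₁⟫_ℝ = 1 / 2) (h2 : ⟪a, c₂⟫_ℝ = 1 / 2) (h12 : ⟪c₁, c₂⟫_ℝ = 1 / 2)
    (hq : b + A (-a) ∈ X) (ho₁ : b + A (c₁ - a) ∈ X) (ho₂ : b + A (c₂ - a) ∈ X)
    (harr : IsArrangedIn ((fun q => (2 : ℝ) • (q - b)) '' {q | q ∈ X ∧ dist b q = 1}) fccKissingPattern ∨
      IsArrangedIn ((fun q => (2 : ℝ) • (q - b)) '' {q | q ∈ X ∧ dist b q = 1}) hcpKissingPattern) :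
    IsMoving X v A (A a) b := by
  have hs₁ : c₁ - a ∈ fccSlots := sub_mem_fccSlots_of_inner_eq_half hc₁ ha (by rw [real_inner_comm]; exact h1)
  have hs₂ : c₂ - a ∈ fccSlots := sub_mem_fccSlots_of_inner_eq_half hc₂ ha (by rw [real_inner_comm]; exact h2)
  have hna : -a ∈ fccSlots := neg_mem_fccSlots ha
  rcases fullShell_or_twinDozen_of_isArrangedIn harr A hs₁ hs₂ hna (linearIndependent_face_from_vertex ha hc₁ hc₂ h1 h2 h12) ho₁ ho₂ hq with hfull |
      ⟨n, hn, hmenu, hown, hmirr, hfar, -, -, hna0⟩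
  · exact Or.inl hfull
  · have hge : 0 ≤ ⟪A a, n⟫_ℝ := by rw [map_neg, inner_neg_left] at hna0; linarith
    have hpos : (0 : ℝ) < Real.sqrt (2 / 3) := Real.sqrt_pos.2 (by norm_num)
    have hd : ⟪A a, n⟫_ℝ = Real.sqrt (2 / 3) ∨ ⟪A a, n⟫_ℝ = 0 := by
      rcases hmenu a ha with h | h | h
      · exact Or.inr h
      · exact Or.inl h
      · linarith
    exact Or.inr (Or.inl ⟨n, ⟨⟨hn, hmenu⟩, hown, hmirr, hfar⟩, hd⟩)

/-! ### A twelve-fold (A)-end ball is not arranged -/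

/-- **END-BALL RIGIDITY.** An (A)-end ball `b` of a pair `(b, q)` (plate systems with slot roots) does NOT have an fcc/hcp-arranged contact shell: the reader `q` and two
face mates are three independent exact slots of the class frame at `b`, so an arranged shell would make `b` moving.  (No kissing facts, no E1.) -/
theorem not_arranged_of_isEndPairA {v : WordVersion} {S₁ S₂ : PlateSystem} (h₁ : S₁.RT ⊆ fccSlots) (h₂ : S₂.RT ⊆ fccSlots) {b q : EuclideanSpace ℝ (Fin 3)}
    (hp : IsEndPairA X v S₁ S₂ b q) :
    ¬ (IsArrangedIn ((fun x => (2 : ℝ) • (x - b)) '' {x | x ∈ X ∧ dist b x = 1}) fccKissingPattern ∨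
      IsArrangedIn ((fun x => (2 : ℝ) • (x - b)) '' {x | x ∈ X ∧ dist b x = 1}) hcpKissingPattern) := by
  intro harr
  obtain ⟨hq, -, -, G, d, hadm, -, hmove⟩ := hp
  obtain ⟨⟨u, hu, hdu⟩, -⟩ : (∃ w ∈ fccSlots, d = G w) ∧ (∃ w ∈ fccSlots, -d = G w) := by
    rcases hadm with h | h
    · exact exists_slots_of_adm h₁ h
    · exact exists_slots_of_adm h₂ h
  rcases hmove with ⟨hrd, hbq, hnm⟩ | ⟨m, htw, hdm, hbq, hnm⟩
  · -- straight moves: frame `G`, slot `a = u`, reader `q = b + G(−u)`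
    have hqb : b + G (-u) = q := by rw [hbq, hdu, map_neg]; abel
    have face : ∀ {c₁ c₂ : EuclideanSpace ℝ (Fin 3)}, c₁ ∈ fccSlots → c₂ ∈ fccSlots → ⟪u, c₁⟫_ℝ = 1 / 2 → ⟪u, c₂⟫_ℝ = 1 / 2 → ⟪c₁, c₂⟫_ℝ = 1 / 2 →
        q + G c₁ ∈ X → q + G c₂ ∈ X → False := by
      intro c₁ c₂ hc₁ hc₂ i1 i2 i12 o1 o2
      have e1 : b + G (c₁ - u) = q + G c₁ := by rw [hbq, hdu, map_sub]; abel
      have e2 : b + G (c₂ - u) = q + G c₂ := by rw [hbq, hdu, map_sub]; abel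
      have hmov := isMoving_of_arranged_face (v := v) G hu hc₁ hc₂ i1 i2 i12 (by rw [hqb]; exact hq) (by rw [e1]; exact o1) (by rw [e2]; exact o2) harr
      rw [← hdu] at hmov
      exact hnm hmov
    rcases hrd with hf | ⟨-, hn⟩ | ⟨m, htw, hdm0⟩
    · obtain ⟨c₁, hc₁, c₂, hc₂, i1, i2, i12⟩ := exists_slot_triangle hu
      exact face hc₁ hc₂ i1 i2 i12 (hf _ hc₁) (hf _ hc₂)
    · obtain ⟨-, m, hm, hdm, hocc⟩ := hn
      obtain ⟨u₁, hu₁, u₂, hu₂, u₃, hu₃, n1, n2, n3, i12, i13, i23, -, huniq⟩ := exists_far_frame G hm.1 hm.2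
      have hpos : (0 : ℝ) < Real.sqrt (2 / 3) := Real.sqrt_pos.2 (by norm_num)
      have hposu : 0 < ⟪G u, m⟫_ℝ := by rw [← hdu, hdm]; exact hpos
      have o1 : q + G u₁ ∈ X := hocc _ hu₁ (by rw [n1]; exact hpos)
      have o2 : q + G u₂ ∈ X := hocc _ hu₂ (by rw [n2]; exact hpos)
      have o3 : q + G u₃ ∈ X := hocc _ hu₃ (by rw [n3]; exact hpos)
      rcases huniq u hu hposu with rfl | rfl | rfl
      · exact face hu₂ hu₃ i12 i13 i23 o2 o3
      · exact face hu₁ hu₃ (by rw [real_inner_comm]; exact i12) i23 i13 o1 o3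
      · exact face hu₁ hu₂ (by rw [real_inner_comm]; exact i13) (by rw [real_inner_comm]; exact i23) i12 o1 o2
    · have h0 : ⟪G u, m⟫_ℝ ≤ 0 := by rw [← hdu, hdm0]
      obtain ⟨c₁, hc₁, c₂, hc₂, i1, i2, i12, s1, s2⟩ := exists_lower_slot_triangle G htw.1 hu h0
      exact face hc₁ hc₂ i1 i2 i12 (htw.2.1 _ hc₁ s1) (htw.2.1 _ hc₂ s2)
  · -- cross move: frame `G' = R_m ∘ G`, slot `a = −u`; the reader and the two other mirror balls are exact in `G'`
    set G' := G.trans (ℝ ∙ m)ᗮ.reflection with hG'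
    have hm1 : ‖m‖ = 1 := htw.1.1
    have hRapp : ∀ x : EuclideanSpace ℝ (Fin 3), (ℝ ∙ m)ᗮ.reflection x = x - (2 * ⟪x, m⟫_ℝ) • m := fun x => reflection_unit_apply hm1 x
    have hG'app : ∀ w, G' w = G w - (2 * ⟪G w, m⟫_ℝ) • m := fun w => by rw [hG']; exact hRapp (G w)
    have hpos : (0 : ℝ) < Real.sqrt (2 / 3) := Real.sqrt_pos.2 (by norm_num)
    -- the positive triple of `−m` (= negative triple of `m`) contains `−u`
    have hmenu' : ∀ w ∈ fccSlots, ⟪G w, -m⟫_ℝ = 0 ∨ ⟪G w, -m⟫_ℝ = Real.sqrt (2 / 3) ∨ ⟪G w, -m⟫_ℝ = -Real.sqrt (2 / 3) := by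
      intro w hw
      rcases htw.1.2 w hw with h | h | h
      · exact Or.inl (by rw [inner_neg_right, h, neg_zero])
      · exact Or.inr (Or.inr (by rw [inner_neg_right, h]))
      · exact Or.inr (Or.inl (by rw [inner_neg_right, h, neg_neg]))
    have hnm1 : ‖-m‖ = 1 := by rw [norm_neg, hm1]
    obtain ⟨u₁, hu₁, u₂, hu₂, u₃, hu₃, n1, n2, n3, i12, i13, i23, -, huniq⟩ := exists_far_frame G hnm1 hmenu'
    have hnu : -u ∈ fccSlots := neg_mem_fccSlots hu
    have hposnu : 0 < ⟪G (-u), -m⟫_ℝ := by rw [map_neg, inner_neg_neg, ← hdu, hdm]; exact hpos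
    have neg_of : ∀ {w : EuclideanSpace ℝ (Fin 3)}, ⟪G w, -m⟫_ℝ = Real.sqrt (2 / 3) → ⟪G w, m⟫_ℝ < 0 := by
      intro w h; rw [inner_neg_right] at h; linarith
    -- occupied balls at `b` in the frame `G'`: the reader `q = b + G'(u)` and the mirror balls `q + G' uⱼ = b + G'(uⱼ + u)`
    have hbq' : b = q - G' u := by rw [hbq, hG'app, ← hdu]
    have hqb : b + G' (-(-u)) = q := by rw [neg_neg, hbq']; abel
    have mirr : ∀ {w : EuclideanSpace ℝ (Fin 3)}, w ∈ fccSlots → ⟪G w, -m⟫_ℝ = Real.sqrt (2 / 3) → b + G' (w - -u) = q + (G w - (2 * ⟪G w, m⟫_ℝ) • m) := by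
      intro w hw h
      rw [sub_neg_eq_add, map_add, ← hG'app w, hbq']; abel
    have face : ∀ {c₁ c₂ : EuclideanSpace ℝ (Fin 3)}, c₁ ∈ fccSlots → c₂ ∈ fccSlots → ⟪-u, c₁⟫_ℝ = 1 / 2 → ⟪-u, c₂⟫_ℝ = 1 / 2 → ⟪c₁, c₂⟫_ℝ = 1 / 2 →
        ⟪G c₁, -m⟫_ℝ = Real.sqrt (2 / 3) → ⟪G c₂, -m⟫_ℝ = Real.sqrt (2 / 3) → False := by
      intro c₁ c₂ hc₁ hc₂ i1 i2 i12 n1' n2'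
      have o1 : b + G' (c₁ - -u) ∈ X := by rw [mirr hc₁ n1']; exact htw.2.2.1 _ hc₁ (neg_of n1')
      have o2 : b + G' (c₂ - -u) ∈ X := by rw [mirr hc₂ n2']; exact htw.2.2.1 _ hc₂ (neg_of n2')
      have hmov := isMoving_of_arranged_face (v := v) G' hnu hc₁ hc₂ i1 i2 i12 (by rw [hqb]; exact hq) o1 o2 harr
      have hdir : G' (-u) = b - q := by rw [hbq', map_neg]; abel
      rw [hdir] at hmov
      exact hnm hmov
    rcases huniq (-u) hnu hposnu with e | e | e
    · rw [e] at face
      exact face hu₂ hu₃ i12 i13 i23 n2 n3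
    · rw [e] at face
      exact face hu₁ hu₃ (by rw [real_inner_comm]; exact i12) i23 i13 n1 n3
    · rw [e] at face
      exact face hu₁ hu₂ (by rw [real_inner_comm]; exact i13) (by rw [real_inner_comm]; exact i23) i12 n1 n2

open scoped Classical in
/-- **A twelve-fold (A)-end ball has two distinct unsaturated contact-neighbours** (the exported two-payer clause, re-derived from `IsEndPairA` under the kissing facts). -/
theorem two_unsaturated_of_isEndPairA_twelve {δ : ℝ} (hg : KissingGap δ) (hc : KissingClassification δ) (hX : ∀ p ∈ X, ∀ q ∈ X, p ≠ q → 1 ≤ dist p q)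
    {v : WordVersion} {S₁ S₂ : PlateSystem} (h₁ : S₁.RT ⊆ fccSlots) (h₂ : S₂.RT ⊆ fccSlots) {b q : EuclideanSpace ℝ (Fin 3)} (hp : IsEndPairA X v S₁ S₂ b q)
    (h12 : (X.filter fun x => dist b x = 1).card = 12) :
    ∃ y ∈ X, ∃ y' ∈ X, y ≠ y' ∧ dist b y = 1 ∧ dist b y' = 1 ∧ (X.filter fun x => dist y x = 1).card ≠ 12 ∧ (X.filter fun x => dist y' x = 1).card ≠ 12 :=
  two_unsaturated_of_not_closePacked hg hc hX h12 (not_arranged_of_isEndPairA h₁ h₂ hp)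

/-! ### `ThreePayer` from two saturation-census facts -/

open scoped Classical in
/-- **SATURATION CENSUS, ELEVEN (named input)**: in a `1`-separated configuration a ball with exactly eleven contacts has two distinct contact-neighbours with at most
eleven contacts each. -/
def SatCensus11 : Prop :=
  ∀ X : Finset (EuclideanSpace ℝ (Fin 3)), (∀ p ∈ X, ∀ q ∈ X, p ≠ q → 1 ≤ dist p q) →
  ∀ b ∈ X, (X.filter fun x => dist b x = 1).card = 11 →
    ∃ y ∈ X, ∃ y' ∈ X, y ≠ y' ∧ dist b y = 1 ∧ dist b y' = 1 ∧ (X.filter fun x => dist y x = 1).card ≤ 11 ∧ (X.filter fun x => dist y' x = 1).card ≤ 11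

open scoped Classical in
/-- **SATURATION CENSUS, TWELVE (named input)**: in a `1`-separated configuration a ball with twelve contacts whose contact shell is NOT arranged in the fcc or the hcp
kissing pattern has contact-neighbours of total deficiency at least `3`. -/
def SatCensus12 : Prop :=
  ∀ X : Finset (EuclideanSpace ℝ (Fin 3)), (∀ p ∈ X, ∀ q ∈ X, p ≠ q → 1 ≤ dist p q) →
  ∀ b ∈ X, (X.filter fun x => dist b x = 1).card = 12 →
    ¬ (IsArrangedIn ((fun x => (2 : ℝ) • (x - b)) '' {x | x ∈ X ∧ dist b x = 1}) fccKissingPattern ∨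
      IsArrangedIn ((fun x => (2 : ℝ) • (x - b)) '' {x | x ∈ X ∧ dist b x = 1}) hcpKissingPattern) →
    3 ≤ ∑ y ∈ X.filter (fun y => dist b y = 1 ∧ (X.filter fun x => dist y x = 1).card ≤ 11), ((12 : ℝ) - ((X.filter fun x => dist y x = 1).card : ℝ))

open scoped Classical in
/-- **`ThreePayer` from the two census facts** (and END-BALL RIGIDITY).  Cases on the degree of the end ball `b ≠ z`: `≤ 10` — `b` (two units) and the payer `z` (one
unit); `= 11` — `b` and the two unsaturated neighbours of `SatCensus11`; `= 12` — `b` is not arranged (`not_arranged_of_isEndPairA`), so `SatCensus12` gives three units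
among its contacts. -/
theorem threePayer_of_census (c11 : SatCensus11) (c12 : SatCensus12) : ThreePayer := by
  intro Y hY z hz hdeg v S₁ S₂ h₁ h₂ b q hzb hbz hp
  have hb : b ∈ Y := hp.2.1
  set S := Y.filter (fun y => dist b y ≤ 1 ∧ (Y.filter fun x => dist y x = 1).card ≤ 11) with hS
  have hterm : ∀ y ∈ S, (1 : ℝ) ≤ (12 : ℝ) - ((Y.filter fun x => dist y x = 1).card : ℝ) := by
    intro y hy
    have : ((Y.filter fun x => dist y x = 1).card : ℝ) ≤ 11 := by exact_mod_cast (mem_filter.1 hy).2.2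
    linarith
  have hnonneg : ∀ y ∈ S, (0 : ℝ) ≤ (12 : ℝ) - ((Y.filter fun x => dist y x = 1).card : ℝ) := fun y hy => (zero_le_one.trans (hterm y hy))
  have hzS : z ∈ S := mem_filter.2 ⟨hz, by rwa [dist_comm], hdeg⟩
  have h12b := card_filter_dist_eq_one_le_twelve Y hY b
  unfold pooledDef
  by_cases h10 : (Y.filter fun x => dist b x = 1).card ≤ 10
  · -- `b` contributes `≥ 2`, `z` contributes `≥ 1`
    have hbS : b ∈ S := mem_filter.2 ⟨hb, by simp, by omega⟩
    have hsub : ({b, z} : Finset (EuclideanSpace ℝ (Fin 3))) ⊆ S := insert_subset hbS (singleton_subset_iff.2 hzS)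
    have hbterm : (2 : ℝ) ≤ (12 : ℝ) - ((Y.filter fun x => dist b x = 1).card : ℝ) := by
      have : ((Y.filter fun x => dist b x = 1).card : ℝ) ≤ 10 := by exact_mod_cast h10
      linarith
    calc (3 : ℝ) ≤ ((12 : ℝ) - ((Y.filter fun x => dist b x = 1).card : ℝ)) + ((12 : ℝ) - ((Y.filter fun x => dist z x = 1).card : ℝ)) := by
          linarith [hterm z hzS]
      _ = ∑ y ∈ ({b, z} : Finset (EuclideanSpace ℝ (Fin 3))), ((12 : ℝ) - ((Y.filter fun x => dist y x = 1).card : ℝ)) := by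
          rw [sum_pair hbz]
      _ ≤ ∑ y ∈ S, ((12 : ℝ) - ((Y.filter fun x => dist y x = 1).card : ℝ)) := sum_le_sum_of_subset_of_nonneg hsub fun y hy _ => hnonneg y hy
  · by_cases h11 : (Y.filter fun x => dist b x = 1).card = 11
    · -- `b` and two unsaturated neighbours
      obtain ⟨y, hy, y', hy', hne, hd, hd', hle, hle'⟩ := c11 Y hY b hb h11
      have hbS : b ∈ S := mem_filter.2 ⟨hb, by simp, by omega⟩
      have hyS : y ∈ S := mem_filter.2 ⟨hy, hd.le, hle⟩
      have hy'S : y' ∈ S := mem_filter.2 ⟨hy', hd'.le, hle'⟩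
      have hby : b ≠ y := fun h => by rw [← h, dist_self] at hd; exact zero_ne_one hd
      have hby' : b ≠ y' := fun h => by rw [← h, dist_self] at hd'; exact zero_ne_one hd'
      have hsub : ({b, y, y'} : Finset (EuclideanSpace ℝ (Fin 3))) ⊆ S :=
        insert_subset hbS (insert_subset hyS (singleton_subset_iff.2 hy'S))
      have hcard : ({b, y, y'} : Finset (EuclideanSpace ℝ (Fin 3))).card = 3 := by
        rw [card_insert_of_notMem (by simp [hby, hby']), card_pair hne]
      calc (3 : ℝ) = ∑ _y ∈ ({b, y, y'} : Finset (EuclideanSpace ℝ (Fin 3))), (1 : ℝ) := by simp [hcard]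
        _ ≤ ∑ w ∈ ({b, y, y'} : Finset (EuclideanSpace ℝ (Fin 3))), ((12 : ℝ) - ((Y.filter fun x => dist w x = 1).card : ℝ)) :=
            sum_le_sum fun w hw => hterm w (hsub hw)
        _ ≤ ∑ w ∈ S, ((12 : ℝ) - ((Y.filter fun x => dist w x = 1).card : ℝ)) := sum_le_sum_of_subset_of_nonneg hsub fun w hw _ => hnonneg w hw
    · -- `b` saturated: not arranged, census twelve
      have h12 : (Y.filter fun x => dist b x = 1).card = 12 := by omega
      have hsum := c12 Y hY b hb h12 (not_arranged_of_isEndPairA h₁ h₂ hp)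
      refine hsum.trans (sum_le_sum_of_subset_of_nonneg (fun y hy => ?_) fun y hy _ => hnonneg y hy)
      obtain ⟨hyY, hd, hle⟩ := mem_filter.1 hy
      exact mem_filter.2 ⟨hyY, hd.le, hle⟩

end TailResidue

end Summit.Ventures.Crystal3D.Theorems

end
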